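import Summits.HodgeConjecture.CorCM.Census.EvenSliceFacesDescent
import Summits.HodgeConjecture.CorCM.Census.DicyclicTwistFaces

/-!
# The dicyclic twist `Dic(A) ⊃ ℤ/2 × A`, III: the potential, reducing faces through every non-residual label, and the descent to the
# residual labels

COR-CM (cell `pub-hodgecm2`, stage 2 of the Hodge ladder), count-neutral KERNEL COMBINATORICS by the binder seat b23 (gen 42; claim
DICYCLIC-COLUMN, HOME/INBOX.md l.10328): part III of the lane `DicyclicTwistModel` → `DicyclicTwistFaces` → `DicyclicTwistDescent` →
`DicyclicTwistFunctionals` → `DicyclicTwistResidual` → `DicyclicTwistGenerate` → `DicyclicTwistCount`.  Bookkeeping definitions with bodies (`pot`,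
`redFace`) + theorems on top of parts I–II and seat b09's odd slice (`wt`, `clsTy`, `δ`, `faceVec` corner weights), used BY NAME; no `decide`
table, no certificate, no named fact, no geometry, no `sorry`.  `Interfaces.lean` (C1), every E term, B01, `Transposition/*`, `PortJoin/*` untouched.
HONEST FRAMING: `HC_CM` is NOT proved, here or anywhere in the tree; nothing here is a period, a count of record or a headline.

CONTENT (dictionary of parts I–II).  §1 THE POTENTIAL `pot (ψ₀, ψ₁) = cls ψ₀ + cls ψ₁`, `cls ψ = min (wt ψ, |A| − wt ψ)` b09's defect class
(`clsTy`): invariant under conjugation and under both motions (`pot_conj`, `pot_twH`, `pot_twX`); single flips: `wt (φ + δ i) = wt φ ∓ 1`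
(`wt_add_delta_of_zero`, seat b09's `EvenSliceFacesDescent.wt_add_delta_of_apply_eq_one`); REDUCING PLACES: a label of class `≥ 2` has two places whose single and double flips lower the class
(`exists_two_reducing` — two defects in the lower half, two non-defects in the upper half), a label of class `1` has a place whose flip makes it
constant (`exists_one_reducing`).  §2 THE REDUCING FACE `redFace Ψ` through every label of potential `≥ 2` (the RESIDUAL labels are those of
potential `≤ 1`: `(const, const)`, `(const, δ_s^±)`, `(δ_s^±, const)`): a `0`-coordinate square at two reducing places of `ψ₀` if `cls ψ₀ ≥ 2`,
else a `1`-coordinate square if `cls ψ₁ ≥ 2`, else (`cls ψ₀ = cls ψ₁ = 1`) the mixed face at the two reducing places; **`redFace_spec`**: it is `1`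
at `Ψ` and otherwise supported on labels of SMALLER potential (its other three corners), and it is a Hodge vector (`redFace_mem`).  §3 THE
DESCENT (pure bookkeeping, no pairs needed): if a submodule `S` contains, through every label of potential `K ≥ 2`, a vector which is `1` there
and otherwise supported in potential `< K` (e.g. `S ∋ redFace Ψ` for all non-residual `Ψ`, or the span of the translates of one reducing face per
block, part VII), then **every exponent vector is congruent modulo `S` to a vector supported on the residual labels** (`descent₂`,
`exists_reduced₂`).  Parts IV–VI close the residual labels with `2|A| + 2` functionals and two equator-crossing squares.  All [folklore].

## References
* [Pohlmann1968] H. Pohlmann, Algebraic cycles on abelian varieties of complex multiplication type, Ann. of Math. 88 (1968), Thm 1.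
-/

namespace Summit.HodgeConjecture.CorCM.Census.DicyclicTwist

open Finset
open Summit.HodgeConjecture.CorCM.Census.OddSliceFacesModel
open Summit.HodgeConjecture.CorCM.Census.OddSliceFacesSquares
open Summit.HodgeConjecture.CorCM.Census.OddSliceFacesDescent
open Summit.HodgeConjecture.CorCM.Census.EvenSliceFacesDescent

variable (A : Type) [AddCommGroup A] [Fintype A] [DecidableEq A]

/-! ## §1 Single flips, the defect class, the potential -/

omit [AddCommGroup A] [Fintype A] in
/-- `δ i + δ i = 0`. [folklore] -/
theorem delta_add_delta (i : A) : δ A i + δ A i = (0 : Ty A) := by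
  funext s
  simp only [Pi.add_apply, delta_apply, Pi.zero_apply]
  have h11 : (1 : ZMod 2) + 1 = 0 := by decide
  split_ifs <;> simp [h11]

omit [AddCommGroup A] [DecidableEq A] in
/-- A type with a defect has positive weight. [folklore] -/
theorem wt_pos_of_one {φ : Ty A} {i : A} (hi : φ i = 1) : 1 ≤ wt A φ := by
  unfold wt
  exact Finset.card_pos.mpr ⟨i, by simp [hi]⟩

omit [AddCommGroup A] in
/-- Adding a defect raises the weight by one: `wt (φ + δ i) = wt φ + 1` for `φ i = 0`. [folklore] -/
theorem wt_add_delta_of_zero {φ : Ty A} {i : A} (hi : φ i = 0) : wt A (φ + δ A i) = wt A φ + 1 := by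
  have hi' : (φ + δ A i) i = 1 := by simp [delta_apply, hi]
  have h := wt_add_delta_of_apply_eq_one A hi'
  rw [add_assoc, delta_add_delta, add_zero] at h
  have hpos := wt_pos_of_one A hi'
  omega

omit [DecidableEq A] in
/-- The weight is invariant under reversal. [folklore] -/
theorem wt_rev (φ : Ty A) : wt A (rev A φ) = wt A φ := by
  unfold wt rev
  refine Finset.card_equiv (Equiv.neg A) ?_
  intro s
  simp

omit [DecidableEq A] in
/-- The defect class is invariant under reversal. [folklore] -/
theorem clsTy_rev (φ : Ty A) : clsTy A (rev A φ) = clsTy A φ := by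
  unfold clsTy; rw [wt_rev]

omit [AddCommGroup A] [DecidableEq A] in
/-- The defect class is at most the weight and at most the co-weight. [folklore] -/
theorem clsTy_le (φ : Ty A) : clsTy A φ ≤ wt A φ ∧ clsTy A φ ≤ Fintype.card A - wt A φ :=
  ⟨min_le_left _ _, min_le_right _ _⟩

/-- **The potential** of a label of `(Dic(A), c)`: `pot (ψ₀, ψ₁) = cls ψ₀ + cls ψ₁`. [folklore] -/
def pot (Ψ : Ty₂ A) : ℕ := clsTy A Ψ.1 + clsTy A Ψ.2

omit [DecidableEq A] in
/-- The potential is invariant under conjugation. [folklore] -/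
theorem pot_conj (Ψ : Ty₂ A) : pot A (conj A Ψ) = pot A Ψ := by
  simp only [pot, conj, clsTy_add_one]

omit [DecidableEq A] in
/-- The potential is invariant under the diagonal motions. [folklore] -/
theorem pot_twH (g : ZMod 2 × A) (Ψ : Ty₂ A) : pot A (twH A g Ψ) = pot A Ψ := by
  simp only [pot, twH, clsTy_tw]

omit [DecidableEq A] in
/-- The potential is invariant under the swap-twist. [folklore] -/
theorem pot_twX (Ψ : Ty₂ A) : pot A (twX A Ψ) = pot A Ψ := by
  simp only [pot, twX, clsTy_add_one, clsTy_rev]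
  exact add_comm _ _

omit [AddCommGroup A] in
/-- **Two reducing places** of a type of class `≥ 2`: single flips and the double flip lower the class. [folklore] -/
theorem exists_two_reducing {φ : Ty A} (h2 : 2 ≤ clsTy A φ) :
    ∃ p : A × A, p.1 ≠ p.2 ∧ clsTy A (φ + δ A p.1) < clsTy A φ ∧ clsTy A (φ + δ A p.2) < clsTy A φ ∧
      clsTy A (φ + δ A p.1 + δ A p.2) < clsTy A φ ∧ ((wt A (φ + δ A p.1) ≤ Fintype.card A / 2) ↔ (wt A φ ≤ Fintype.card A / 2)) ∧ ((wt A (φ + δ A p.2) ≤ Fintype.card A / 2) ↔ (wt A φ ≤ Fintype.card A / 2)) ∧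
      ((wt A (φ + δ A p.1 + δ A p.2) ≤ Fintype.card A / 2) ↔ (wt A φ ≤ Fintype.card A / 2)) := by
  have hle := clsTy_le A φ
  by_cases hlow : wt A φ ≤ Fintype.card A / 2
  · have hcls : clsTy A φ = wt A φ := by unfold clsTy; omega
    obtain ⟨i, j, hij, hi, hj⟩ := exists_two_defects A (φ := φ) (by omega)
    have r1 : clsTy A (φ + δ A i) < clsTy A φ := by
      have := (clsTy_le A (φ + δ A i)).1; rw [wt_add_delta_of_apply_eq_one A hi] at this; omega
    have r2 : clsTy A (φ + δ A j) < clsTy A φ := by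
      have := (clsTy_le A (φ + δ A j)).1; rw [wt_add_delta_of_apply_eq_one A hj] at this; omega
    have r3 : clsTy A (φ + δ A i + δ A j) < clsTy A φ := by
      have := (clsTy_le A (φ + δ A i + δ A j)).1; rw [wt_corner_flip A hi hj hij] at this; omega
    have l1 : (wt A (φ + δ A i) ≤ Fintype.card A / 2) ↔ (wt A φ ≤ Fintype.card A / 2) := by rw [wt_add_delta_of_apply_eq_one A hi]; omega
    have l2 : (wt A (φ + δ A j) ≤ Fintype.card A / 2) ↔ (wt A φ ≤ Fintype.card A / 2) := by rw [wt_add_delta_of_apply_eq_one A hj]; omega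
    have l3 : (wt A (φ + δ A i + δ A j) ≤ Fintype.card A / 2) ↔ (wt A φ ≤ Fintype.card A / 2) := by rw [wt_corner_flip A hi hj hij]; omega
    exact ⟨(i, j), hij, r1, r2, r3, l1, l2, l3⟩
  · have hwle := wt_le A φ
    have hcls : clsTy A φ = Fintype.card A - wt A φ := by unfold clsTy; omega
    have h2' : 2 ≤ wt A (φ + 1) := by rw [wt_add_one]; omega
    obtain ⟨i, j, hij, hi, hj⟩ := exists_two_defects A h2'
    have key : ∀ u : ZMod 2, u + 1 = 1 → u = 0 := by decide
    have hi0 : φ i = 0 := key _ (by simpa using hi)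
    have hj0 : φ j = 0 := key _ (by simpa using hj)
    have hj0' : (φ + δ A i) j = 0 := by simp [delta_apply, Ne.symm hij, hj0]
    have hwi := wt_add_delta_of_zero A hi0
    have hwj := wt_add_delta_of_zero A hj0
    have hwij := wt_add_delta_of_zero A hj0'
    rw [hwi] at hwij
    have hwle' := wt_le A (φ + δ A i + δ A j)
    have r1 : clsTy A (φ + δ A i) < clsTy A φ := by
      have := (clsTy_le A (φ + δ A i)).2; omega
    have r2 : clsTy A (φ + δ A j) < clsTy A φ := by
      have := (clsTy_le A (φ + δ A j)).2; omega
    have r3 : clsTy A (φ + δ A i + δ A j) < clsTy A φ := by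
      have := (clsTy_le A (φ + δ A i + δ A j)).2; omega
    have l1 : (wt A (φ + δ A i) ≤ Fintype.card A / 2) ↔ (wt A φ ≤ Fintype.card A / 2) := by omega
    have l2 : (wt A (φ + δ A j) ≤ Fintype.card A / 2) ↔ (wt A φ ≤ Fintype.card A / 2) := by omega
    have l3 : (wt A (φ + δ A i + δ A j) ≤ Fintype.card A / 2) ↔ (wt A φ ≤ Fintype.card A / 2) := by omega
    exact ⟨(i, j), hij, r1, r2, r3, l1, l2, l3⟩

omit [AddCommGroup A] in
/-- **The reducing place** of a type of class `1`: its flip is a constant type. [folklore] -/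
theorem exists_one_reducing {φ : Ty A} (h1 : clsTy A φ = 1) :
    ∃ s : A, clsTy A (φ + δ A s) = 0 ∧ ((wt A (φ + δ A s) ≤ Fintype.card A / 2) ↔ (wt A φ ≤ Fintype.card A / 2)) := by
  have hle := clsTy_le A φ
  have hwle := wt_le A φ
  by_cases hlow : wt A φ ≤ Fintype.card A / 2
  · have hw : wt A φ = 1 := by unfold clsTy at h1; omega
    rcases eq_zero_or_eq_delta_of_wt_le_one A (χ := φ) (by omega) with h0 | ⟨s, hs⟩
    · rw [h0, wt_zero] at hw; omega
    · refine ⟨s, ?_, ?_⟩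
      · rw [hs, delta_add_delta]
        unfold clsTy; rw [wt_zero]; simp
      · rw [hs, delta_add_delta]
        rw [wt_zero, ← hs]; omega
  · have hw : wt A (φ + 1) = 1 := by rw [wt_add_one]; unfold clsTy at h1; omega
    rcases eq_zero_or_eq_delta_of_wt_le_one A (χ := φ + 1) (by omega) with h0 | ⟨s, hs⟩
    · rw [h0, wt_zero] at hw; omega
    · have hφ : φ + δ A s = 1 := by
        have : φ = δ A s + 1 := by rw [← hs, add_one_add_one]
        rw [this, add_right_comm, delta_add_delta, zero_add]
      have hw1 : wt A (1 : Ty A) = Fintype.card A := by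
        have := wt_add_one A (0 : Ty A); rw [zero_add, wt_zero] at this; omega
      refine ⟨s, ?_, ?_⟩
      · rw [hφ]; unfold clsTy; rw [hw1]; simp
      · rw [hφ]; rw [hw1]; omega

/-! ## §2 The reducing face through a non-residual label -/

/-- Data of the reducing face through `Ψ`: two reducing places of `ψ₀` if `cls ψ₀ ≥ 2`, else of `ψ₁` if `cls ψ₁ ≥ 2`, else the two single
reducing places (a choice; junk `(0,0)` on residual labels). [folklore] -/
noncomputable def redPlaces (Ψ : Ty₂ A) : A × A :=
  if h0 : 2 ≤ clsTy A Ψ.1 then (exists_two_reducing A h0).choose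
  else if h1 : 2 ≤ clsTy A Ψ.2 then (exists_two_reducing A h1).choose
  else if h2 : clsTy A Ψ.1 = 1 ∧ clsTy A Ψ.2 = 1 then
    ((exists_one_reducing A h2.1).choose, (exists_one_reducing A h2.2).choose)
  else (0, 0)

/-- **The reducing face through `Ψ`** (a `0`-coordinate square, a `1`-coordinate square or a mixed face; junk `0` on residual labels).
[folklore] -/
noncomputable def redFace (Ψ : Ty₂ A) : Ty₂ A → ℤ :=
  if 2 ≤ clsTy A Ψ.1 then faceVec₀ A Ψ.1 (redPlaces A Ψ).1 (redPlaces A Ψ).2 Ψ.2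
  else if 2 ≤ clsTy A Ψ.2 then faceVec₁ A Ψ.1 Ψ.2 (redPlaces A Ψ).1 (redPlaces A Ψ).2
  else if clsTy A Ψ.1 = 1 ∧ clsTy A Ψ.2 = 1 then faceVecM A Ψ.1 (redPlaces A Ψ).1 Ψ.2 (redPlaces A Ψ).2
  else 0

omit [AddCommGroup A] [DecidableEq A] in
/-- A sum of four unit vectors whose last three labels have smaller potential than the first is `1` at the first label and otherwise
supported in smaller potential. [folklore] -/
theorem isRed_of_corners {Ψ c₂ c₃ c₄ : Ty₂ A} (h₂ : pot A c₂ < pot A Ψ) (h₃ : pot A c₃ < pot A Ψ) (h₄ : pot A c₄ < pot A Ψ) :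
    (Pi.single Ψ 1 + Pi.single c₂ 1 + Pi.single c₃ 1 + Pi.single c₄ 1 : Ty₂ A → ℤ) Ψ = 1 ∧
      ∀ χ, χ ≠ Ψ → (Pi.single Ψ 1 + Pi.single c₂ 1 + Pi.single c₃ 1 + Pi.single c₄ 1 : Ty₂ A → ℤ) χ ≠ 0 → pot A χ < pot A Ψ := by
  have n₂ : Ψ ≠ c₂ := fun h => by rw [h] at h₂; exact lt_irrefl _ h₂
  have n₃ : Ψ ≠ c₃ := fun h => by rw [h] at h₃; exact lt_irrefl _ h₃
  have n₄ : Ψ ≠ c₄ := fun h => by rw [h] at h₄; exact lt_irrefl _ h₄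
  refine ⟨by simp [n₂, n₃, n₄], fun χ hχ hv => ?_⟩
  simp only [Pi.add_apply, Pi.single_apply, if_neg hχ, zero_add] at hv
  by_cases e₂ : χ = c₂
  · rw [e₂]; exact h₂
  by_cases e₃ : χ = c₃
  · rw [e₃]; exact h₃
  by_cases e₄ : χ = c₄
  · rw [e₄]; exact h₄
  simp [e₂, e₃, e₄] at hv

/-- Potential of a conjugated corner: `pot (φ + 1 + δ i, ψ + 1) = cls (φ + δ i) + cls ψ`. [folklore] -/
theorem pot_bar_corner (φ ψ : Ty A) (i : A) : pot A (φ + 1 + δ A i, ψ + 1) = clsTy A (φ + δ A i) + clsTy A ψ := by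
  simp only [pot, add_right_comm φ 1 (δ A i), clsTy_add_one]

/-- The same in the `1`-coordinate. [folklore] -/
theorem pot_bar_corner' (ψ φ : Ty A) (i : A) : pot A (ψ + 1, φ + 1 + δ A i) = clsTy A ψ + clsTy A (φ + δ A i) := by
  simp only [pot, add_right_comm φ 1 (δ A i), clsTy_add_one]

/-- The reducing data on a label with `cls ψ₀ ≥ 2`. [folklore] -/
theorem redFace_eq₀ {ψ₀ ψ₁ : Ty A} (h0 : 2 ≤ clsTy A ψ₀) :
    redPlaces A (ψ₀, ψ₁) = (exists_two_reducing A h0).choose ∧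
      redFace A (ψ₀, ψ₁) = faceVec₀ A ψ₀ (redPlaces A (ψ₀, ψ₁)).1 (redPlaces A (ψ₀, ψ₁)).2 ψ₁ := by
  constructor
  · unfold redPlaces; exact dif_pos h0
  · unfold redFace; exact if_pos h0

/-- The reducing data on a label with `cls ψ₀ ≤ 1`, `cls ψ₁ ≥ 2`. [folklore] -/
theorem redFace_eq₁ {ψ₀ ψ₁ : Ty A} (h0 : ¬ 2 ≤ clsTy A ψ₀) (h1 : 2 ≤ clsTy A ψ₁) :
    redPlaces A (ψ₀, ψ₁) = (exists_two_reducing A h1).choose ∧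
      redFace A (ψ₀, ψ₁) = faceVec₁ A ψ₀ ψ₁ (redPlaces A (ψ₀, ψ₁)).1 (redPlaces A (ψ₀, ψ₁)).2 := by
  constructor
  · unfold redPlaces; rw [dif_neg h0]; exact dif_pos h1
  · unfold redFace; rw [if_neg h0]; exact if_pos h1

/-- The reducing data on a label with `cls ψ₀ = cls ψ₁ = 1`. [folklore] -/
theorem redFace_eqM {ψ₀ ψ₁ : Ty A} (h0 : ¬ 2 ≤ clsTy A ψ₀) (h1 : ¬ 2 ≤ clsTy A ψ₁) (h2 : clsTy A ψ₀ = 1 ∧ clsTy A ψ₁ = 1) :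
    redPlaces A (ψ₀, ψ₁) = ((exists_one_reducing A h2.1).choose, (exists_one_reducing A h2.2).choose) ∧
      redFace A (ψ₀, ψ₁) = faceVecM A ψ₀ (redPlaces A (ψ₀, ψ₁)).1 ψ₁ (redPlaces A (ψ₀, ψ₁)).2 := by
  constructor
  · unfold redPlaces; rw [dif_neg h0, dif_neg h1]; exact dif_pos h2
  · unfold redFace; rw [if_neg h0, if_neg h1]; exact if_pos h2

/-- **The reducing face is `1` at its label and otherwise supported in smaller potential** (`pot Ψ ≥ 2`). [folklore] -/
theorem redFace_spec {Ψ : Ty₂ A} (h : 2 ≤ pot A Ψ) :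
    redFace A Ψ Ψ = 1 ∧ ∀ χ, χ ≠ Ψ → redFace A Ψ χ ≠ 0 → pot A χ < pot A Ψ := by
  obtain ⟨ψ₀, ψ₁⟩ := Ψ
  have hp : pot A (ψ₀, ψ₁) = clsTy A ψ₀ + clsTy A ψ₁ := rfl
  by_cases h0 : 2 ≤ clsTy A ψ₀
  · obtain ⟨eP, eF⟩ := redFace_eq₀ A (ψ₁ := ψ₁) h0
    obtain ⟨hij, hi, hj, hij', -, -, -⟩ := (exists_two_reducing A h0).choose_spec
    rw [eF, eP]
    unfold faceVec₀
    refine isRed_of_corners A ?_ ?_ ?_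
    · rw [pot_bar_corner, hp]; omega
    · rw [pot_bar_corner, hp]; omega
    · rw [hp]; unfold pot; simp only; omega
  · by_cases h1 : 2 ≤ clsTy A ψ₁
    · obtain ⟨eP, eF⟩ := redFace_eq₁ A h0 h1
      obtain ⟨hij, hi, hj, hij', -, -, -⟩ := (exists_two_reducing A h1).choose_spec
      rw [eF, eP]
      unfold faceVec₁
      refine isRed_of_corners A ?_ ?_ ?_
      · rw [pot_bar_corner', hp]; omega
      · rw [pot_bar_corner', hp]; omega
      · rw [hp]; unfold pot; simp only; omega
    · have h2 : clsTy A ψ₀ = 1 ∧ clsTy A ψ₁ = 1 := by rw [hp] at h; omega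
      obtain ⟨eP, eF⟩ := redFace_eqM A h0 h1 h2
      have hs := (exists_one_reducing A h2.1).choose_spec.1
      have ht := (exists_one_reducing A h2.2).choose_spec.1
      rw [eF, eP]
      unfold faceVecM
      simp only
      have e3 : ψ₁ + 1 + δ A (exists_one_reducing A h2.2).choose = ψ₁ + δ A (exists_one_reducing A h2.2).choose + 1 :=
        add_right_comm _ _ _
      refine isRed_of_corners A ?_ ?_ ?_
      · rw [pot_bar_corner, hs, h2.2, hp]; omega
      · rw [e3, hp]; unfold pot; simp only [clsTy_add_one]; rw [ht, h2.1]; omega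
      · rw [hp]; unfold pot; simp only; rw [hs, ht]; omega

/-- **The reducing face is a Hodge vector** (`pot Ψ ≥ 2`). [folklore] -/
theorem redFace_mem {Ψ : Ty₂ A} (h : 2 ≤ pot A Ψ) : redFace A Ψ ∈ hodge₂ A := by
  obtain ⟨ψ₀, ψ₁⟩ := Ψ
  have hp : pot A (ψ₀, ψ₁) = clsTy A ψ₀ + clsTy A ψ₁ := rfl
  by_cases h0 : 2 ≤ clsTy A ψ₀
  · obtain ⟨eP, eF⟩ := redFace_eq₀ A (ψ₁ := ψ₁) h0
    rw [eF, eP]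
    exact faceVec₀_mem A _ (exists_two_reducing A h0).choose_spec.1 _
  · by_cases h1 : 2 ≤ clsTy A ψ₁
    · obtain ⟨eP, eF⟩ := redFace_eq₁ A h0 h1
      rw [eF, eP]
      exact faceVec₁_mem A _ _ (exists_two_reducing A h1).choose_spec.1
    · have h2 : clsTy A ψ₀ = 1 ∧ clsTy A ψ₁ = 1 := by rw [hp] at h; omega
      obtain ⟨eP, eF⟩ := redFace_eqM A h0 h1 h2
      rw [eF]
      exact faceVecM_mem A _ _ _ _

/-! ## §3 The descent to the residual labels -/

omit [AddCommGroup A] in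
/-- **Clearing step.**  If `S` contains through every label of potential `K ≥ 2` a vector which is `1` there and otherwise supported in
potential `< K`, a vector supported in potential `≤ K` is congruent modulo `S` to one supported in potential `≤ K − 1`. [folklore] -/
theorem clear_step₂ (S : Submodule ℤ (Ty₂ A → ℤ)) {K : ℕ} (hK : 2 ≤ K)
    (hcover : ∀ Ψ : Ty₂ A, pot A Ψ = K → ∃ v ∈ S, v Ψ = 1 ∧ ∀ χ, χ ≠ Ψ → v χ ≠ 0 → pot A χ < K)
    (m : Ty₂ A → ℤ) (hm : ∀ χ, m χ ≠ 0 → pot A χ ≤ K) :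
    ∃ m' : Ty₂ A → ℤ, (∀ χ, m' χ ≠ 0 → pot A χ ≤ K - 1) ∧ m - m' ∈ S := by
  choose! F hFmem hFone hFlt using hcover
  set L : Finset (Ty₂ A) := univ.filter fun Ψ => pot A Ψ = K with hL
  set q : Ty₂ A → ℤ := ∑ Ψ ∈ L, m Ψ • F Ψ with hq
  have hqmem : q ∈ S := Submodule.sum_mem _ fun Ψ hΨ => Submodule.smul_mem _ _ (hFmem Ψ (Finset.mem_filter.mp hΨ).2)
  have hqval : ∀ χ : Ty₂ A, K ≤ pot A χ → q χ = if pot A χ = K then m χ else 0 := by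
    intro χ hχ
    rw [hq, Finset.sum_apply]
    have hterm : ∀ Ψ ∈ L, (m Ψ • F Ψ) χ = if χ = Ψ then m Ψ else 0 := by
      intro Ψ hΨ
      have hΨK : pot A Ψ = K := (Finset.mem_filter.mp hΨ).2
      rw [Pi.smul_apply, smul_eq_mul]
      by_cases e : χ = Ψ
      · rw [if_pos e, e, hFone Ψ hΨK, mul_one]
      · rw [if_neg e]
        by_cases hz : F Ψ χ = 0
        · rw [hz, mul_zero]
        · exact absurd (hFlt Ψ hΨK χ e hz) (by omega)
    rw [Finset.sum_congr rfl hterm, Finset.sum_ite_eq]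
    have hLmem : χ ∈ L ↔ pot A χ = K := by rw [hL]; simp
    by_cases hχK : pot A χ = K
    · rw [if_pos (hLmem.mpr hχK), if_pos hχK]
    · rw [if_neg (fun h' => hχK (hLmem.mp h')), if_neg hχK]
  refine ⟨m - q, ?_, ?_⟩
  · intro χ hχ
    by_contra hKχ
    have hKle : K ≤ pot A χ := by omega
    apply hχ
    rw [Pi.sub_apply, hqval χ hKle]
    by_cases hχK : pot A χ = K
    · rw [if_pos hχK, sub_self]
    · rw [if_neg hχK, sub_zero]
      by_contra hmχ
      exact hχK (le_antisymm (hm χ hmχ) hKle)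
  · have : m - (m - q) = q := by abel
    rw [this]; exact hqmem

omit [AddCommGroup A] in
/-- **Descent.**  Under the same hypothesis for all `2 ≤ K' ≤ K`, a vector supported in potential `≤ K` is congruent modulo `S` to a vector
supported on the residual labels (potential `≤ 1`). [folklore] -/
theorem descent₂ (S : Submodule ℤ (Ty₂ A → ℤ))
    (hcover : ∀ Ψ : Ty₂ A, 2 ≤ pot A Ψ → ∃ v ∈ S, v Ψ = 1 ∧ ∀ χ, χ ≠ Ψ → v χ ≠ 0 → pot A χ < pot A Ψ)
    (K : ℕ) (m : Ty₂ A → ℤ) (hm : ∀ χ, m χ ≠ 0 → pot A χ ≤ K) :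
    ∃ r : Ty₂ A → ℤ, (∀ χ, r χ ≠ 0 → pot A χ ≤ 1) ∧ m - r ∈ S := by
  induction K generalizing m with
  | zero => exact ⟨m, fun χ h => (hm χ h).trans (Nat.zero_le 1), by rw [sub_self]; exact Submodule.zero_mem _⟩
  | succ K ih =>
    by_cases hK1 : K + 1 ≤ 1
    · exact ⟨m, fun χ h => (hm χ h).trans hK1, by rw [sub_self]; exact Submodule.zero_mem _⟩
    · obtain ⟨m', hm', hdiff⟩ := clear_step₂ A S (K := K + 1) (by omega)
        (fun Ψ hΨ => by
          obtain ⟨v, hv, h1, h2⟩ := hcover Ψ (by omega)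
          exact ⟨v, hv, h1, fun χ hχ hz => by rw [← hΨ]; exact h2 χ hχ hz⟩) m hm
      obtain ⟨r, hr, hdiff'⟩ := ih m' (fun χ h => by have := hm' χ h; omega)
      refine ⟨r, hr, ?_⟩
      have : m - r = (m - m') + (m' - r) := by abel
      rw [this]
      exact Submodule.add_mem _ hdiff hdiff'

omit [AddCommGroup A] [DecidableEq A] in
/-- The potential is bounded by `|A|`. [folklore] -/
theorem pot_le (Ψ : Ty₂ A) : pot A Ψ ≤ Fintype.card A := by
  unfold pot clsTy
  have h0 := wt_le A Ψ.1
  have h1 := wt_le A Ψ.2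
  omega

/-- **Every exponent vector is congruent, modulo any submodule containing the reducing faces through all non-residual labels, to a vector
supported on the residual labels.** [folklore] -/
theorem exists_reduced₂ (S : Submodule ℤ (Ty₂ A → ℤ)) (hS : ∀ Ψ : Ty₂ A, 2 ≤ pot A Ψ → redFace A Ψ ∈ S) (m : Ty₂ A → ℤ) :
    ∃ r : Ty₂ A → ℤ, (∀ χ, r χ ≠ 0 → pot A χ ≤ 1) ∧ m - r ∈ S :=
  descent₂ A S (fun Ψ hΨ => ⟨redFace A Ψ, hS Ψ hΨ, redFace_spec A hΨ⟩) (Fintype.card A) m (fun χ _ => pot_le A χ)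

end Summit.HodgeConjecture.CorCM.Census.DicyclicTwist
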